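import Summits.BirchSwinnertonDyer.BirchSwinnertonDyer.Theorems.GenusKolyvaginAtTwoPowDvdShaCardAtTwoRTExactSwapCore
import Summits.BirchSwinnertonDyer.BirchSwinnertonDyer.Theorems.KolyvaginRankRigidityAtTwoSwapAuxClassGlobalAtTwo
import Summits.BirchSwinnertonDyer.BirchSwinnertonDyer.Theorems.KolyvaginRankRigidityAtTwoSwapWeilDatumLiftChange
import Summits.BirchSwinnertonDyer.Rank1Residual.JET.TransverseFamilyConjAct
import Summits.BirchSwinnertonDyer.BirchSwinnertonDyer.Theorems.KolyvaginRankRigidityAtTwoTransversePackageAtTwo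
import Summits.BirchSwinnertonDyer.BirchSwinnertonDyer.Theorems.KolyvaginRankRigidityAtTwoTransverseClassAtTwo
import Summits.BirchSwinnertonDyer.BirchSwinnertonDyer.Theorems.ByReductionTypeAtTwoRankOneAtTwoBigImageOddLocalOneDoorBottomLemma43AtTwo
import HarnessLib

/-!
# Route `GenusKolyvaginAtTwo`, LINE 18 (L_T `PowDvdShaCardAtTwoRT`, stmt-BirchSwinnertonDyer-23242), stub KS — the exact prime swap at 2 on the
# HYBRID transverse frame: P4, P8, P5 (the signed auxiliary class), τ-stability and T2 (t = 0, odd Tamagawa) DISCHARGED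

LEAD seat `bsd-line-gk2-p1` g18 (cell `bsd-f1-sign2`), `--supports stmt-BirchSwinnertonDyer-23242` (helper; closes nothing).  THEOREMS ONLY;
BSD is not proved by any of this; neither is the crux, nor stub KS.  Sequel of `…RTExactSwapCore` (`exactSwap_core`, p727522).

`exactSwap_core_hybrid`: on per-level HYBRID transverse structures `𝒯 M` (ring-class transverse condition at the Kolyvagin places of index
`≥ M + 1`, Kummer elsewhere — hypotheses `hTko` / `hTku`, the shape produced by KRR's `exists_hybridTransverseFamily`), a conjugation-compatible
perfect Poitou–Tate family per level (`hperf`, `hvan`, `hinvc`, `hSC`) and a `τ`-equivariant Weil datum per level (`hτe`), the displayed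
hypotheses P8 `h𝒯sd`, P4 `hP4`, P5 `hP5` and T2 of `exactSwap_core` are THEOREMS — VERBATIM the discharge of KRR's
`primeSwapAtTwoLossy_core_hybrid_nine` (`dualTransported_eq_of_hybrid`, `JET.localization_kolyvaginClass_mem_globalTransverse_two` = (V44) at
margin one, `JET.Walk.globalTransverse_conjActPlace_mem`, `exists_auxClass_large_at_two` = krr2-p2's SIGNED auxiliary class, p635450) — and T2
with `t = 0` is Gross 6.2(1) / McCallum 4.3 at `2` on the odd-Tamagawa habitat (`RankOneAtTwoOneDoor.kolyvaginClass_two_mem_selmerLocalKer_of_odd_tamagawaProduct`).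
What stays displayed: the two EXACT local laws `hP7a` / `hP7b` (gk2-p3 lineage's sockets), Q2 by name, (NPh) at level `2^(M+k)`.

References: [McCallumLMS1991] §5 Prop. 5.2 (proof), Lemma 5.3, Lemma 4.3; [Kolyvagin1991MathAnn] §2 Thm. 2.2; [GrossLMS1991] Prop. 6.2 (1);
[Howard2004HeegnerKolyvagin] Lemma 2.7.3, Prop. 2.1.9.
-/

set_option autoImplicit false
set_option linter.dupNamespace false

noncomputable section

open scoped Classical Pointwise
open Function NumberField IsDedekindDomain WeierstrassCurve Field
open Literature.NumberTheory.EllipticCurves Literature.NumberTheory.GaloisRepresentations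
open Literature.NumberTheory.EllipticCurves.Jetchev2008 Literature.NumberTheory.EllipticCurves.ModularForms
open Literature.NumberTheory.GaloisCohomology
open Literature.NumberTheory.GaloisRepresentations.DiscreteGaloisModule (localTatePairingZMod
  tateDual transverseSubgroup SelmerStructure)
open Literature.NumberTheory.Automorphic
open Summit.BirchSwinnertonDyer.Rank1Residual
open Summit.BirchSwinnertonDyer.Rank1Residual.JET.SelmerVocabulary
open Summit.BirchSwinnertonDyer.Rank1Residual.JET.GlobalDuality
open Summit.BirchSwinnertonDyer.BirchSwinnertonDyer.Theses.GenusKolyvaginAtTwo (KolyvaginRelationAtTwo)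
open Summit.BirchSwinnertonDyer.BirchSwinnertonDyer.Theorems.KolyvaginLowerBoundAtTwo

namespace Summit.BirchSwinnertonDyer.BirchSwinnertonDyer.Theorems.GenusExact.PlusDescent

/-- **T2 with `t = 0` on the odd-Tamagawa habitat, in the shape the swap cores consume** (`KolSupp` / `levelIndex` currency):
`c_M(n)` is Kummer at every finite place not dividing `n` — Gross 6.2 (1) / McCallum Lemma 4.3 at `2` with odd local Tamagawa numbers
(`RankOneAtTwoOneDoor.kolyvaginClass_two_mem_selmerLocalKer_of_odd_tamagawaProduct`). [cite: GrossLMS1991, Prop. 6.2 (1)] [cite: McCallumLMS1991, §4 Lemma 4.3] -/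
theorem pow_zero_zsmul_kolyvaginClass_two_mem_selmerLocalKer_of_odd_tamagawaProduct {K : Type} [Field K] [NumberField K]
    (W : WeierstrassCurve ℚ) [W.IsElliptic] [W.IsGloballyMinimal] [NeZero (W.conductorNorm ℤ)]
    (hsur : ∀ m : ℕ, W.HasSurjectiveModNGaloisRep (2 ^ m : ℕ)) (hTam : Odd W.tamagawaProduct)
    (hK : IsImaginaryQuadratic K) (hne3 : NumberField.discr K ≠ -3) (hne4 : NumberField.discr K ≠ -4)
    (hHN : SatisfiesHeegnerHypothesis (W.conductorNorm ℤ) K)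
    (Dt : ModularParametrizationData W (W.conductorNorm ℤ)) (β : ℤ) (ι : K →+* ℂ) :
    ∀ (n : ℕ) (d : KolyvaginHeegnerData Dt β ι n) (M : ℕ),
      KolyvaginDescent.KolSupp (Zhang2014.IsKolyvaginPrime (W.conductorNorm ℤ) W K 2) n →
      1 ≤ M → (M : ℕ∞) ≤ Zhang2014.levelIndex W 2 n →
      ∀ v : HeightOneSpectrum (𝓞 K), ((n : ℕ) : 𝓞 K) ∉ v.asIdeal →
        ((2 ^ 0 : ℕ) : ℤ) • d.kolyvaginClass Nat.prime_two M ∈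
          selmerLocalKer (W.baseChange K) (v.adicCompletion K) ((2 ^ M : ℕ) : ℤ) := by
  intro n d M hn _ hlev v hv
  have hsurj' : ∀ k : ℕ, W.HasSurjectiveModNGaloisRep ((2 ^ k : ℕ) : ℤ) := fun k ↦ by exact_mod_cast hsur k
  rw [pow_zero, Nat.cast_one, one_zsmul]
  exact RankOneAtTwoOneDoor.kolyvaginClass_two_mem_selmerLocalKer_of_odd_tamagawaProduct W hsurj' hTam K hK hne3 hne4
    hHN Dt β ι M hn.1 (fun q hq ↦ ⟨hn.2 q hq, Zhang2014.natCast_le_levelIndex_iff.mp hlev q hq⟩) d v hv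

section Frame

variable {K : Type} [Field K] [NumberField K] (W : WeierstrassCurve ℚ) [W.IsElliptic]
  [W.IsGloballyMinimal] [(W.baseChange K).IsElliptic] [NeZero (W.conductorNorm ℤ)]
  [∀ M : ℕ, NeZero (2 ^ M)] [∀ M : ℕ, Finite (geomTorsion (W.baseChange K) ((2 ^ M : ℕ) : ℤ))]
  (τ : K ≃ₐ[ℚ] K)
  (Dt : ModularParametrizationData W (W.conductorNorm ℤ)) (β : ℤ) (ι : K →+* ℂ)
  [∀ j : ℕ, NumberField (ringClassField K ι j)]
  (e : ∀ M : ℕ, geomTorsion (W.baseChange K) ((2 ^ M : ℕ) : ℤ) →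
    geomTorsion (W.baseChange K) ((2 ^ M : ℕ) : ℤ) → AlgebraicClosure K)
  (hμ : ∀ M S T, e M S T ^ (2 ^ M) = 1)
  (hadd₁ : ∀ M S₁ S₂ T, e M (S₁ + S₂) T = e M S₁ T * e M S₂ T)
  (hadd₂ : ∀ M S T₁ T₂, e M S (T₁ + T₂) = e M S T₁ * e M S T₂)
  (hgal : ∀ M (g : absoluteGaloisGroup K) (S T : geomTorsion (W.baseChange K) ((2 ^ M : ℕ) : ℤ)),
    g • e M S T = e M (g • S) (g • T))
  (halt : ∀ M T, e M T T = 1) (hnondeg : ∀ M T, (∀ S, e M S T = 1) → T = 0)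
  (hτe : ∀ (M : ℕ) S T, liftAut τ (e M S T) =
    e M ((isLiftOfAut_liftAut τ).torsionMap W ((2 ^ M : ℕ) : ℤ) S)
      ((isLiftOfAut_liftAut τ).torsionMap W ((2 ^ M : ℕ) : ℤ) T))
  (inv : ∀ M : ℕ, LocalInvariants K (2 ^ M))
  (𝒯 : ∀ M : ℕ, SelmerStructure ((W.baseChange K).torsionGaloisModule ((2 ^ M : ℕ) : ℤ)))
  -- the habitat of LINE 18
  (hCM : ¬ W.HasCM) (hΔ : W.Δ < 0) (hTam : Odd W.tamagawaProduct)
  (hsur : ∀ m : ℕ, W.HasSurjectiveModNGaloisRep (2 ^ m : ℕ)) (hK : IsImaginaryQuadratic K)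
  (hodd : Odd (NumberField.discr K)) (hne3 : NumberField.discr K ≠ -3)
  (hns : ¬ IsSquare ((NumberField.discr K : ℚ) * -|W.Δ|))
  (hHN : SatisfiesHeegnerHypothesis (W.conductorNorm ℤ) K)
  (hτ1 : τ ≠ 1)
  (hperf : ∀ M, (inv M).IsPerfect) (hvan : ∀ M, (inv M).SumLocalTermEqZero)
  (hinvc : ∀ M, (inv M).IsConjCompatible τ) (hSC : ∀ M, (inv M).SelmerComplement)
  -- the hybrid transverse structures
  (hTko : ∀ (M : ℕ) (v : HeightOneSpectrum (𝓞 K)) (q : ℕ),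
    Zhang2014.IsKolyvaginPrime (W.conductorNorm ℤ) W K 2 q → M + 1 ≤ Zhang2014.kolyvaginIndex W 2 q →
    (q : 𝓞 K) ∈ v.asIdeal →
    𝒯 M (Sum.inr v) = ⨅ (w' : HeightOneSpectrum (𝓞 (ringClassField K ι q)))
        (_ : w'.asIdeal.LiesOver v.asIdeal),
        letI := (adicCompletionOfLiesOver K (ringClassField K ι q) v w').toAlgebra
        transverseSubgroup (GaloisRep.toLocal v ((W.baseChange K).torsionGaloisModule ((2 ^ M : ℕ) : ℤ)))
          (w'.adicCompletion (ringClassField K ι q)))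
  (hTku : ∀ (M : ℕ) (v : HeightOneSpectrum (𝓞 K)),
    (¬ ∃ q : ℕ, Zhang2014.IsKolyvaginPrime (W.conductorNorm ℤ) W K 2 q ∧
        M + 1 ≤ Zhang2014.kolyvaginIndex W 2 q ∧ (q : 𝓞 K) ∈ v.asIdeal) →
    𝒯 M (Sum.inr v) = (W.baseChange K).kummerSelmerStructure ((2 ^ M : ℕ) : ℤ) (Sum.inr v))
  -- the two EXACT local laws (sockets of the gk2-p3 lineage)
  (hP7a : ∀ (M M' ℓ : ℕ) (v : HeightOneSpectrum (𝓞 K))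
    (w C : galoisCohomology ((W.baseChange K).torsionGaloisModule ((2 ^ M : ℕ) : ℤ)) 1) (s : ℤ) (a b : ℕ),
    (s = 1 ∨ s = -1) → Zhang2014.IsKolyvaginPrime (W.conductorNorm ℤ) W K 2 ℓ →
    M ≤ Zhang2014.kolyvaginIndex W 2 ℓ → M ≤ M' → FrobEqFrobInfty W K (2 ^ M') ℓ →
    ((ℓ : ℕ) : 𝓞 K) ∈ v.asIdeal →
    conjAct W τ ((2 ^ M : ℕ) : ℤ) w = s • w → conjAct W τ ((2 ^ M : ℕ) : ℤ) C = s • C →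
    galoisCohomology.localization ((W.baseChange K).torsionGaloisModule ((2 ^ M : ℕ) : ℤ)) (Sum.inr v) 1 w ∈
      (W.baseChange K).kummerSelmerStructure ((2 ^ M : ℕ) : ℤ) (Sum.inr v) →
    ((2 ^ a : ℕ) : ℤ) • galoisCohomology.localization ((W.baseChange K).torsionGaloisModule ((2 ^ M : ℕ) : ℤ))
      (Sum.inr v) 1 w ≠ 0 →
    ((2 ^ b : ℕ) : ℤ) • galoisCohomology.localization ((W.baseChange K).torsionGaloisModule ((2 ^ M : ℕ) : ℤ))
      (Sum.inr v) 1 C ∉ (W.baseChange K).kummerSelmerStructure ((2 ^ M : ℕ) : ℤ) (Sum.inr v) →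
    M ≤ a + b →
    (2 ^ (a + b - M) : ℕ) •
        localTatePairingZMod ((W.baseChange K).torsionGaloisModule ((2 ^ M : ℕ) : ℤ)) (2 ^ M) (Sum.inr v)
          (inv M (Sum.inr v))
          (galoisCohomology.localization ((W.baseChange K).torsionGaloisModule ((2 ^ M : ℕ) : ℤ)) (Sum.inr v) 1 w)
          (galoisCohomology.localization (((W.baseChange K).torsionGaloisModule ((2 ^ M : ℕ) : ℤ)).tateDual (2 ^ M))
            (Sum.inr v) 1
            (galoisCohomology.map (weilDualIntertwining (W.baseChange K) (2 ^ M) (e M) (hμ M) (hadd₁ M) (hadd₂ M)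
              (hgal M)) 1 C)) ≠ 0)
  (hP7b : ∀ (M q : ℕ) (v : HeightOneSpectrum (𝓞 K))
    (w C : galoisCohomology ((W.baseChange K).torsionGaloisModule ((2 ^ M : ℕ) : ℤ)) 1) (s : ℤ) (a₀ b₀ : ℕ),
    (s = 1 ∨ s = -1) → Zhang2014.IsKolyvaginPrime (W.conductorNorm ℤ) W K 2 q →
    M + 1 ≤ Zhang2014.kolyvaginIndex W 2 q → ((q : ℕ) : 𝓞 K) ∈ v.asIdeal →
    conjAct W τ ((2 ^ M : ℕ) : ℤ) w = s • w → conjAct W τ ((2 ^ M : ℕ) : ℤ) C = s • C →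
    galoisCohomology.localization ((W.baseChange K).torsionGaloisModule ((2 ^ M : ℕ) : ℤ)) (Sum.inr v) 1 C ∈
      𝒯 M (Sum.inr v) →
    ((2 ^ a₀ : ℕ) : ℤ) • galoisCohomology.localization ((W.baseChange K).torsionGaloisModule ((2 ^ M : ℕ) : ℤ))
      (Sum.inr v) 1 w ∈ 𝒯 M (Sum.inr v) →
    ((2 ^ b₀ : ℕ) : ℤ) • galoisCohomology.localization ((W.baseChange K).torsionGaloisModule ((2 ^ M : ℕ) : ℤ))
      (Sum.inr v) 1 C = 0 →
    (2 ^ (a₀ + b₀ - M - 1) : ℕ) •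
        localTatePairingZMod ((W.baseChange K).torsionGaloisModule ((2 ^ M : ℕ) : ℤ)) (2 ^ M) (Sum.inr v)
          (inv M (Sum.inr v))
          (galoisCohomology.localization ((W.baseChange K).torsionGaloisModule ((2 ^ M : ℕ) : ℤ)) (Sum.inr v) 1 w)
          (galoisCohomology.localization (((W.baseChange K).torsionGaloisModule ((2 ^ M : ℕ) : ℤ)).tateDual (2 ^ M))
            (Sum.inr v) 1
            (galoisCohomology.map (weilDualIntertwining (W.baseChange K) (2 ^ M) (e M) (hμ M) (hadd₁ M) (hadd₂ M)
              (hgal M)) 1 C)) = 0)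
  (hQ2 : KolyvaginRelationAtTwo)

include halt hnondeg hτe hCM hΔ hTam hsur hK hodd hne3 hns hHN hτ1 hperf hvan hinvc hSC hTko hTku hP7a hP7b hQ2 in
/-- **The exact prime swap at `2` on the HYBRID transverse frame** — `exactSwap_core` with P8 (`dualTransported_eq_of_hybrid`), P4
(`JET.localization_kolyvaginClass_mem_globalTransverse_two`, i.e. (V44) at margin one, unconditional), the `τ`-stability of the hybrid structure
(`JET.Walk.globalTransverse_conjActPlace_mem`), P5 (krr2-p2's signed auxiliary class `exists_auxClass_large_at_two`) and T2 with `t = 0`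
(`kolyvaginClass_two_mem_selmerLocalKer_of_odd_tamagawaProduct`) DISCHARGED.  Conclusion = that of `exactSwap_core` plus the LEVEL-2 Gross condition
`FrobEqFrobInfty W K 2 ℓ` of the fresh prime (gk2-p2's `adm` currency; `FrobEqFrobInfty.of_dvd`).
[cite: McCallumLMS1991, §5 Prop. 5.2 (proof), Lemma 5.3, Lemma 4.3] [cite: Howard2004HeegnerKolyvagin, Lemma 2.7.3] [cite: GrossLMS1991, Prop. 6.2] -/
theorem exactSwap_core_hybrid {M k g n a : ℕ} (X : Finset ℕ) (dat : KolyvaginHeegnerData Dt β ι n)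
    (hM : 12 ≤ M) (hk : 1 ≤ k) (hn : Squarefree n)
    (hnK : ∀ p ∈ n.primeFactors, Zhang2014.IsKolyvaginPrime (W.conductorNorm ℤ) W K 2 p ∧
      M + 1 ≤ Zhang2014.kolyvaginIndex W 2 p)
    (ha : a ∈ n.primeFactors) (hg : 1 ≤ g) (hord : addOrderOf (dat.kolyvaginClass Nat.prime_two M) = 2 ^ g)
    (hroom : M + 6 ≤ M / 2 + g)
    (hNPh : ∀ z : galH1Torsion (W.baseChange K) ((2 ^ (M + k) : ℕ) : ℤ),
      (∀ ρ ∈ torsionFixing (W.baseChange K) ((2 ^ (M + k) : ℕ) : ℤ),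
        h1Eval (W.baseChange K) ((2 ^ (M + k) : ℕ) : ℤ) z ρ = 0) →
      (∀ w : HeightOneSpectrum (𝓞 K), ((2 * W.conductorNorm ℤ : ℕ) : 𝓞 K) ∈ w.asIdeal →
        z ∈ selmerLocalKer (W.baseChange K) (w.adicCompletion K) ((2 ^ (M + k) : ℕ) : ℤ)) → z = 0) :
    ∃ ℓ : ℕ, ℓ ∉ X ∧ ℓ ∉ n.primeFactors ∧ Zhang2014.IsKolyvaginPrime (W.conductorNorm ℤ) W K 2 ℓ ∧
      M + k ≤ Zhang2014.kolyvaginIndex W 2 ℓ ∧ FrobEqFrobInfty W K (2 ^ (M + k)) ℓ ∧ FrobEqFrobInfty W K 2 ℓ ∧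
      (∀ v : HeightOneSpectrum (𝓞 K), ((ℓ : ℕ) : 𝓞 K) ∈ v.asIdeal →
        ((2 ^ (g - 1) : ℕ) : ℤ) • dat.kolyvaginClass Nat.prime_two M ∉
          (W.baseChange K).torsionLocalKer (v.adicCompletion K) ((2 ^ M : ℕ) : ℤ)) ∧
      ∃ dat' : KolyvaginHeegnerData Dt β ι (n / a * ℓ),
        ((2 ^ (g - 1) : ℕ) : ℤ) • dat'.kolyvaginClass Nat.prime_two M ≠ 0 := by
  classical
  haveI : Fact (Nat.Prime 2) := ⟨Nat.prime_two⟩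
  have hne4 : NumberField.discr K ≠ -4 := fun h ↦ by
    rw [h] at hodd; have := Int.odd_iff.mp hodd; omega
  have hD : NumberField.discr K < -4 := IsImaginaryQuadratic.discr_lt_neg_four_of_odd hK hodd hne3
  have hττ : τ * τ = 1 := mul_self_eq_one_of_isImaginaryQuadratic hK τ
  have hinj : ∀ (M : ℕ) (v : HeightOneSpectrum (𝓞 K)), Injective (inv M (Sum.inr v)) :=
    fun M v ↦ ((hperf M) v).1.injective
  -- P8: self-duality of the hybrid structure at every finite place
  have h𝒯sd : ∀ (M c : ℕ), ∀ v ∈ placesDividing K c,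
      (inv M).dualTransported (𝒯 M) (weilDualIntertwining (W.baseChange K) (2 ^ M) (e M) (hμ M) (hadd₁ M)
        (hadd₂ M) (hgal M)) (Sum.inr v) = 𝒯 M (Sum.inr v) := fun M c ↦
    dualTransported_eq_of_hybrid W M (e M) (hμ M) (hadd₁ M) (hadd₂ M) (hgal M) (halt M) (hnondeg M) (inv M)
      (𝒯 M) hK hD ι (hinj M) (fun v ↦ by
        by_cases h : ∃ q : ℕ, Zhang2014.IsKolyvaginPrime (W.conductorNorm ℤ) W K 2 q ∧
            M + 1 ≤ Zhang2014.kolyvaginIndex W 2 q ∧ (q : 𝓞 K) ∈ v.asIdeal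
        · obtain ⟨q, hq, hMq, hqv⟩ := h
          exact Or.inl ⟨q, hq, hMq, hqv, hTko M v q hq hMq hqv⟩
        · exact Or.inr (hTku M v h)) c
  -- P4: transversality at the primes of the conductor — (V44) at margin one, unconditional at 2
  have hP4 : ∀ (M c : ℕ) (dat : KolyvaginHeegnerData Dt β ι c),
      KolyvaginDescent.KolSupp (Zhang2014.IsKolyvaginPrime (W.conductorNorm ℤ) W K 2) c → 1 ≤ M →
      (∀ q ∈ c.primeFactors, M + 1 ≤ Zhang2014.kolyvaginIndex W 2 q) →
      ∀ w ∈ placesDividing K c,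
        galoisCohomology.localization ((W.baseChange K).torsionGaloisModule ((2 ^ M : ℕ) : ℤ)) (Sum.inr w) 1
          (dat.kolyvaginClass Nat.prime_two M) ∈ 𝒯 M (Sum.inr w) := by
    intro M c dat hc _ hcM w hw
    obtain ⟨𝒯g, h𝒯g, -⟩ := JET.Walk.exists_globalTransverseFamily W ι ((2 ^ M : ℕ) : ℤ)
    have hmem := JET.localization_kolyvaginClass_mem_globalTransverse_two W hK hD Dt β ι M h𝒯g dat hc hcM w hw
    obtain ⟨q, hqc, hqw⟩ := (natCast_mem_iff_exists_primeFactor_mem hc.1.ne_zero w).mp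
      ((mem_placesDividing_iff_natCast_mem hc.1.ne_zero w).mp hw)
    rw [hTko M w q (hc.2 q hqc) (hcM q hqc) hqw, ← JET.Walk.globalTransverse_eq_of_natCast_mem h𝒯g w
      (Nat.prime_of_mem_primeFactors hqc) hqw]
    exact hmem
  -- τ-stability of the hybrid structure at the places of a Kolyvagin conductor
  have h𝒯σ : ∀ (M m : ℕ), KolyvaginDescent.KolSupp (Zhang2014.IsKolyvaginPrime (W.conductorNorm ℤ) W K 2) m →
      (∀ q ∈ m.primeFactors, M + 1 ≤ Zhang2014.kolyvaginIndex W 2 q) →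
      ∀ (v w : HeightOneSpectrum (𝓞 K)) (h : τ • v = w), v ∈ placesDividing K m →
      ∀ x : galoisCohomology (((W.baseChange K).torsionGaloisModule ((2 ^ M : ℕ) : ℤ)).toLocal
        (Sum.inr v : Place K)) 1, x ∈ 𝒯 M (Sum.inr v) → conjActPlace W τ ((2 ^ M : ℕ) : ℤ) h x ∈ 𝒯 M (Sum.inr w) := by
    intro M m hm hmidx v w h hv x hx
    obtain ⟨𝒯g, h𝒯g, -⟩ := JET.Walk.exists_globalTransverseFamily W ι ((2 ^ M : ℕ) : ℤ)
    obtain ⟨q, hqm, hqv⟩ := (natCast_mem_iff_exists_primeFactor_mem hm.1.ne_zero v).mp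
      ((mem_placesDividing_iff_natCast_mem hm.1.ne_zero v).mp hv)
    have hq := hm.2 q hqm
    have hvv : τ • v = v := smul_place_eq_self_of_natCast_mem τ hq.1.ne_zero hq.2.2.2.2.1 v hqv
    have hvw : v = w := hvv.symm.trans h
    subst hvw
    have heq : 𝒯 M (Sum.inr v) = 𝒯g (Sum.inr v) := by
      rw [hTko M v q hq (hmidx q hqm) hqv, JET.Walk.globalTransverse_eq_of_natCast_mem h𝒯g v hq.1 hqv]
    rw [heq] at hx ⊢
    exact JET.Walk.globalTransverse_conjActPlace_mem h𝒯g τ hm.1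
      (JET.forall_conjActPlace_mem_of_eq_iInf_transverseSubgroup W hK ι τ _ m) v v h hv x hx
  -- P5: krr2-p2's SIGNED auxiliary class with size on the hybrid structure (M ≥ 9)
  have hP5 : ∀ (M m a : ℕ) (v₀ : HeightOneSpectrum (𝓞 K)) (s : ℤ), (s = 1 ∨ s = -1) → 9 ≤ M →
      KolyvaginDescent.KolSupp (Zhang2014.IsKolyvaginPrime (W.conductorNorm ℤ) W K 2) m →
      (∀ q ∈ m.primeFactors, M + 1 ≤ Zhang2014.kolyvaginIndex W 2 q) →
      Zhang2014.IsKolyvaginPrime (W.conductorNorm ℤ) W K 2 a → M + 1 ≤ Zhang2014.kolyvaginIndex W 2 a →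
      ¬ a ∣ m → ((a : ℕ) : 𝓞 K) ∈ v₀.asIdeal →
      ∃ w : galoisCohomology ((W.baseChange K).torsionGaloisModule ((2 ^ M : ℕ) : ℤ)) 1,
        w ∈ signPart W K τ ((2 ^ M : ℕ) : ℤ) s
          (((selmerF W ((2 ^ M : ℕ) : ℤ) (𝒯 M) (placesDividing K m)).relaxedAt {v₀}).selmerGroup) ∧
        ((2 ^ (M / 2 - 5) : ℕ) : ℤ) • w ≠ 0 := by
    intro M m a v₀ s hs hM9 hm hmidx ha hMa ham hv₀
    have hfix : τ • v₀ = v₀ := smul_place_eq_self_of_natCast_mem τ ha.1.ne_zero ha.2.2.2.2.1 v₀ hv₀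
    have hτe' : ∀ S T, liftAutPlace τ hfix (e M S T) =
        e M ((isLiftOfAut_liftAutPlace τ hfix).torsionMap W ((2 ^ M : ℕ) : ℤ) S)
          ((isLiftOfAut_liftAutPlace τ hfix).torsionMap W ((2 ^ M : ℕ) : ℤ) T) := fun S T ↦
      weil_equivariant_of_isLiftOfAut W ((2 ^ M : ℕ) : ℤ) (isLiftOfAut_liftAutPlace τ hfix) (isLiftOfAut_liftAut τ)
        (e M) (hgal M) (hτe M) S T
    exact exists_auxClass_large_at_two W τ M (e M) (hμ M) (hadd₁ M) (hadd₂ M) (hgal M) (halt M) (hnondeg M) (inv M)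
      (𝒯 M) hK hτ1 hττ (hperf M) (hvan M) (hSC M) (hinvc M) hM9 hm.1.ne_zero (h𝒯sd M m)
      (h𝒯σ M m hm hmidx) ha hMa ham v₀ hv₀ hfix hτe' hs
  -- T2 with t = 0: Gross 6.2(1) / McCallum 4.3 at 2 on the odd-Tamagawa habitat
  have hT2 := pow_zero_zsmul_kolyvaginClass_two_mem_selmerLocalKer_of_odd_tamagawaProduct W hsur hTam hK hne3 hne4 hHN Dt β ι
  obtain ⟨ℓ, hℓX, hℓn, hKol, hidx, hfrob, hdet, d', hd'⟩ := exactSwap_core (W := W) (τ := τ) (Dt := Dt) (β := β) (ι := ι)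
    (e := e) (hμ := hμ) (hadd₁ := hadd₁) (hadd₂ := hadd₂) (hgal := hgal) (halt := halt) (hnondeg := hnondeg) (inv := inv) (𝒯 := 𝒯)
    (hCM := hCM) (hΔ := hΔ) (hsur := hsur) (hK := hK) (hodd := hodd) (hne3 := hne3) (hns := hns) (hHN := hHN) (hτ1 := hτ1)
    (hperf := hperf) (hvan := hvan) (h𝒯sd := h𝒯sd) (hP4 := hP4) (hP5 := hP5) (hP7a := hP7a) (hP7b := hP7b)
    (hQ2 := hQ2) (hT2 := hT2) X dat hM hk hn hnK ha hg hord hroom hNPh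
  exact ⟨ℓ, hℓX, hℓn, hKol, hidx, hfrob, hfrob.of_dvd (dvd_pow_self 2 (by omega)), hdet, d', hd'⟩

end Frame

end Summit.BirchSwinnertonDyer.BirchSwinnertonDyer.Theorems.GenusExact.PlusDescent

end
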